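import Summits.AtomisticToContinuum.HydrodynamicLimit.Theorems.JParityClosureEvenStressEnskogShortFlightDeficitRung0
import Summits.AtomisticToContinuum.HydrodynamicLimit.Theorems.JParityClosureEvenStressEnskogThreeBodyCollisionSumRung0
import Summits.AtomisticToContinuum.HydrodynamicLimit.Theorems.JParityClosureEvenStressEnskogKineticEnergyTight
import Summits.AtomisticToContinuum.HydrodynamicLimit.Theorems.JParityClosureDensityCapMeanDisplacement
import Summits.AtomisticToContinuum.HydrodynamicLimit.Theorems.JParityClosureCollisionTightnessTorusGibbs
import Summits.AtomisticToContinuum.HydrodynamicLimit.Theorems.InformationPercolationEngineCollisionRateTubeRegular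
import Literature.MathematicalPhysics.KineticTheory.CollisionTubePullbackRung0Reduction
import Literature.MathematicalPhysics.KineticTheory.CollisionTubePullbackPacking
import HarnessLib

/-!
# R2 at rung 0: the collision-cylinder pull-back of the UNIT-mark collision statistic under the homogeneous
# Gibbs law (`stub_cylinderPullbackUnitRung0`, line `Sketch`, crux `InformationPercolationEngine.CollisionRate`,
# stmt-AtomisticToContinuum-13481)

The crux `CollisionRate` is the even collision statistic `evenStat σ N Φ τ χ g Ξ r` at the constant mark `Ξ ≡ 1`
(`collisionRate_iff_evenStat_one`); its rung-0 chassis (constant profiles: the local Gibbs law is the flow-invariant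
homogeneous Gibbs law `G_N`) runs on the SPEED-TRUNCATED unit mark `Ξ₁ᴸ(n̂, v, w) = ψ_L(‖w − v‖)` (`speedCutoff`;
`|Ξ₁ᴸ| ≤ 1 ≤ 2L`, continuous, `= 0` for relative speed `≥ 2L`).  The registered stub R2 proved here is the mark-`1`
twin of the sibling's S2|const (`EvenStressEnskog.cylinderPullback_rung0_of_residuals`, crux stmt-13079):
`G_N{|evenStat(Ξ₁ᴸ) − evenTubeTimeStat(Ξ₁ᴸ, κ)| > η} ≤ δ` for `κ < κ₀`, `N ≥ N₀` — every collision is pulled back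
along the free flight of its pair to the static tube functional `tubeStat … Ξ₁ᴸ r r 1 κ t` at one time.

Proof = Boltzmann's collision cylinder on one good orbit (`cylinderPullback_pathwise`,
`Literature/…/CollisionTubePullbackPathwise`, generic in the mark) + three residual concentrations under `G_N`:
* (S2b₂)₀ for EVERY mark bounded by `2L` (`shortFlightDeficitRung0_mark`): `R_short[Ψ] ≤ 2Lκε · #short`
  pathwise and the discharged short-flight window bound `EvenStressEnskog.shortFlightCountRung0_le`;
* (S2b₁)₀ for every such mark: the mark-generic Literature reduction
  `localGibbsLaw_continuityCorrection_rung0_of_shortFlightDeficit` (`Literature/…/CollisionTubePullbackRung0Reduction`)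
  with its rung-0 statics discharged by the tree (`measurePreserving_flow_localGibbsLaw_const`, `exists_sweptTube`,
  `volume_setOf_exists_reprSym_add_latticeVec_mem_le`, `EvenStressEnskog.stub_kineticEnergyTight`,
  `Theorems.stub_meanDisplacement`);
* (S2b₃)₀ the mark-free three-body collision sum `EvenStressEnskog.stub_threeBodyCollisionSumRung0`;
assembled in `cylinderPullbackUnitRung0_of_residuals` (late pairs `O(ε)` by `residual_latePairs`; exact Enskog
slicing `evenStat_sub_evenTubeTimeStat_eq` on good orbits, integrability by
`integrableOn_tubeStat_enskogRate_orbit_of_regular` from the mark-1 S6 `evenTubeStatRegular_one`; union bound off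
the null bad set `localGibbsLaw_goodCompl`).

References: C. Cercignani, R. Illner, M. Pulvirenti, *The Mathematical Theory of Dilute Gases* (1994), §2.2,
App. 4.A; I. Gallagher, L. Saint-Raymond, B. Texier, *From Newton to Boltzmann* (2013), Prop. 4.1.1;
D. Ruelle, *Statistical Mechanics: Rigorous Results* (1969), §4.2.
-/

noncomputable section

open MeasureTheory Set Filter Topology
open scoped ENNReal InnerProductSpace BigOperators

namespace Summit.AtomisticToContinuum.HydrodynamicLimit.Theorems.CollisionRate

open Literature.Analysis.FluidPDE Literature.MathematicalPhysics.KineticTheory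
open Summit.AtomisticToContinuum.HydrodynamicLimit.Theorems.EvenStressEnskog
  (shortFlightCountRung0_le stub_threeBodyCollisionSumRung0 stub_kineticEnergyTight)

/-! ## (S2b₂)₀ for every mark bounded by `2L` -/

/-- **The short-flight deficit at rung 0, for every collision mark bounded by `2L`** (mark-generic form of
the sibling's `EvenStressEnskog.stub_shortFlightDeficitRung0`, crux stmt-13079): under the homogeneous Gibbs law
the normalised short-flight deficit `((N+1)κ)⁻¹ · R_short[Ψ]` of the collision-cylinder pull-back exceeds `η`
with probability at most `δ` for all `κ < κ₀(L, τ, η, δ, u, θ)`, `N ≥ 1` and every mark `Ψ` with `|Ψ| ≤ 2L`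
(`R_short[Ψ] ≤ 2Lκε · #short` pathwise, `shortFlightDeficit_le_mul_count`, and the discharged window bound
`EvenStressEnskog.shortFlightCountRung0_le` with `y = η(N+1)/(2Lε)`, `ℓ = κε`, `(N+1)ε³ = σ³ ≤ 1`). [folklore] -/
theorem shortFlightDeficitRung0_mark : ∃ η₀ : ℝ, 0 < η₀ ∧ ∀ (a θ : ℝ) (u : V3), 0 < a → 0 < θ → ∃ σ₀ : ℝ, 0 < σ₀ ∧ ∀ σ : ℝ, 0 < σ → σ < σ₀ → ∀ Φ : (N : ℕ) → HardSphereFlow (Torus.geometry (Fin 3)) (hsDiameter σ N) (N + 1), ∀ τ : ℝ, 0 < τ → ∀ χ : ℝ × UnitAddTorus (Fin 3) → ℝ, Continuous χ → ∀ g : ℝ → ℝ, Continuous g → (∀ a, η₀ ≤ a → g a = 0) → ∀ η δ : ℝ, 0 < η → 0 < δ → ∃ r₀ : ℝ, 0 < r₀ ∧ ∀ r : ℝ, 0 < r → r < r₀ → ∀ L : ℝ, 1 ≤ L → ∃ κ₀ : ℝ, 0 < κ₀ ∧ ∀ κ : ℝ, 0 < κ → κ < κ₀ → ∃ N₀ :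 ℕ, ∀ N : ℕ, N₀ ≤ N → ∀ Ψ : V3 × V3 × V3 → ℝ, (∀ q, |Ψ q| ≤ 2 * L) → localGibbsLaw σ (fun _ => a) (fun _ => u) (fun _ => θ) N (Φ N) {z | η < ((N + 1 : ℝ) * κ)⁻¹ * shortFlightDeficit σ N (Φ N) τ Ψ κ z} ≤ ENNReal.ofReal δ := by
  refine ⟨1, one_pos, fun a θ u ha hθ => ?_⟩
  obtain ⟨σ₀, hσ₀, hcount⟩ := shortFlightCountRung0_le a θ u ha hθ
  refine ⟨min σ₀ 1, lt_min hσ₀ one_pos, fun σ hσ hσlt Φ τ hτ χ _ g _ _ η δ hη hδ => ⟨1, one_pos, fun r _ _ L hL => ?_⟩⟩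
  have hσ₀' : σ < σ₀ := hσlt.trans_le (min_le_left _ _)
  have hσ1 : σ ≤ 1 := (hσlt.trans_le (min_le_right _ _)).le
  have hL0 : 0 < L := by linarith
  set M₁ : ℝ := 1 + 4 * (‖u‖ ^ 2 + 3 * θ) with hM₁
  have hM₁0 : 0 < M₁ := by positivity
  set A : ℝ := 2 * L * M₁ * (48 + 1728 * τ) / η with hA
  have hA0 : 0 < A := by positivity
  refine ⟨δ / (A + 1), by positivity, fun κ hκ hκlt => ⟨1, fun N hN Ψ hΨ => ?_⟩⟩
  have hε : 0 < hsDiameter σ N := hsDiameter_pos hσ N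
  have hε1 : hsDiameter σ N ≤ 1 := (hsDiameter_le hσ.le N).trans hσ1
  have hℓ : 0 < κ * hsDiameter σ N := mul_pos hκ hε
  have hn : (0 : ℝ) < (N + 1 : ℝ) := by positivity
  set P := localGibbsLaw σ (fun _ => a) (fun _ => u) (fun _ => θ) N (Φ N) with hP
  set y : ℝ := η * (N + 1 : ℝ) / (2 * L * hsDiameter σ N) with hy
  have hy0 : 0 < y := by positivity
  -- pathwise: a large normalised deficit forces a large short-flight count
  set B : Set (Config (N + 1) (Fin 3) T3) := {z | z ∈ (Φ N).good ∧ y ≤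
      collisionPairSum (Torus.geometry (Fin 3)) (hsDiameter σ N) (orbit σ N (Φ N) z) (Set.Icc 0 τ)
        (fun s i j => if s - κ * hsDiameter σ N < pairFlightStart σ N (Φ N) z i j s then (1 : ℝ) else 0)} with hB
  have hsub : {z | η < ((N + 1 : ℝ) * κ)⁻¹ * shortFlightDeficit σ N (Φ N) τ Ψ κ z} ⊆ (Φ N).goodᶜ ∪ B := by
    intro z hz
    by_cases hgood : z ∈ (Φ N).good
    · refine Or.inr ⟨hgood, ?_⟩
      have h1 := shortFlightDeficit_le_mul_count hgood hΨ τ hℓ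
      have h2 : η < ((N + 1 : ℝ) * κ)⁻¹ * shortFlightDeficit σ N (Φ N) τ Ψ κ z := hz
      by_contra hlt
      have hlt' := not_le.1 hlt
      have h3 : shortFlightDeficit σ N (Φ N) τ Ψ κ z < 2 * L * (κ * hsDiameter σ N) * y :=
        h1.trans_lt (mul_lt_mul_of_pos_left hlt' (by positivity))
      have h4 : 2 * L * (κ * hsDiameter σ N) * y = η * ((N + 1 : ℝ) * κ) := by
        rw [hy]; field_simp
      rw [h4] at h3
      have h5 : ((N + 1 : ℝ) * κ)⁻¹ * shortFlightDeficit σ N (Φ N) τ Ψ κ z < η := by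
        rw [inv_mul_lt_iff₀ (by positivity)]; linarith
      linarith
    · exact Or.inl hgood
  have hgood0 : P (Φ N).goodᶜ = 0 := by
    rw [hP, localGibbsLaw_eq]
    exact localGibbsMeasure_absolutelyContinuous σ _ _ _ N (Φ N) (Φ N).measure_compl_good
  have hcnt : P B ≤ _ := hcount σ hσ hσ₀' N hN (Φ N) τ (κ * hsDiameter σ N) y hτ hℓ hy0
  -- arithmetic of the constants
  have hε3 : (N + 1 : ℝ) * hsDiameter σ N ^ 3 = σ ^ 3 := by exact_mod_cast succ_mul_hsDiameter_pow_three σ N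
  have hσ3 : σ ^ 3 ≤ 1 := pow_le_one₀ hσ.le hσ1
  have hne4 : (N + 1 : ℝ) * hsDiameter σ N ^ 4 ≤ 1 := by
    calc (N + 1 : ℝ) * hsDiameter σ N ^ 4 = ((N + 1 : ℝ) * hsDiameter σ N ^ 3) * hsDiameter σ N := by ring
      _ ≤ 1 * 1 := mul_le_mul (hε3 ▸ hσ3) hε1 hε.le zero_le_one
      _ = 1 := one_mul 1
  have hne6 : (N + 1 : ℝ) ^ 2 * hsDiameter σ N ^ 6 ≤ 1 := by
    calc (N + 1 : ℝ) ^ 2 * hsDiameter σ N ^ 6 = (((N + 1 : ℝ) * hsDiameter σ N ^ 3)) ^ 2 := by ring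
      _ ≤ 1 := by rw [hε3]; exact pow_le_one₀ (by positivity) hσ3
  have hkey : M₁ * (κ * hsDiameter σ N) * (48 * (N + 1 : ℝ) ^ 2 * hsDiameter σ N ^ 2 +
      192 * τ * (N + 1 : ℝ) ^ 2 * hsDiameter σ N ^ 2 + 1536 * τ * (N + 1 : ℝ) ^ 3 * hsDiameter σ N ^ 4) / y ≤ δ := by
    rw [div_le_iff₀ hy0, hy]
    have hS : hsDiameter σ N ^ 2 * (48 * (N + 1 : ℝ) ^ 2 * hsDiameter σ N ^ 2 +
        192 * τ * (N + 1 : ℝ) ^ 2 * hsDiameter σ N ^ 2 + 1536 * τ * (N + 1 : ℝ) ^ 3 * hsDiameter σ N ^ 4) ≤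
        (N + 1 : ℝ) * (48 + 1728 * τ) := by
      calc hsDiameter σ N ^ 2 * (48 * (N + 1 : ℝ) ^ 2 * hsDiameter σ N ^ 2 +
            192 * τ * (N + 1 : ℝ) ^ 2 * hsDiameter σ N ^ 2 + 1536 * τ * (N + 1 : ℝ) ^ 3 * hsDiameter σ N ^ 4)
          = (N + 1 : ℝ) * (48 * ((N + 1 : ℝ) * hsDiameter σ N ^ 4) + 192 * τ * ((N + 1 : ℝ) * hsDiameter σ N ^ 4) +
              1536 * τ * ((N + 1 : ℝ) ^ 2 * hsDiameter σ N ^ 6)) := by ring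
        _ ≤ (N + 1 : ℝ) * (48 * 1 + 192 * τ * 1 + 1536 * τ * 1) := by gcongr
        _ = (N + 1 : ℝ) * (48 + 1728 * τ) := by ring
    have hκA : A * κ ≤ δ := by
      have h1 : A * κ ≤ A * (δ / (A + 1)) := mul_le_mul_of_nonneg_left hκlt.le hA0.le
      have h2 : A * (δ / (A + 1)) ≤ δ := by
        rw [mul_div_assoc', div_le_iff₀ (by positivity)]; nlinarith
      exact h1.trans h2
    have hgoal : M₁ * (κ * hsDiameter σ N) * (48 * (N + 1 : ℝ) ^ 2 * hsDiameter σ N ^ 2 +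
        192 * τ * (N + 1 : ℝ) ^ 2 * hsDiameter σ N ^ 2 + 1536 * τ * (N + 1 : ℝ) ^ 3 * hsDiameter σ N ^ 4) *
        (2 * L * hsDiameter σ N) ≤ δ * (η * (N + 1 : ℝ)) := by
      calc M₁ * (κ * hsDiameter σ N) * (48 * (N + 1 : ℝ) ^ 2 * hsDiameter σ N ^ 2 +
            192 * τ * (N + 1 : ℝ) ^ 2 * hsDiameter σ N ^ 2 + 1536 * τ * (N + 1 : ℝ) ^ 3 * hsDiameter σ N ^ 4) *
            (2 * L * hsDiameter σ N)
          = 2 * L * M₁ * κ * (hsDiameter σ N ^ 2 * (48 * (N + 1 : ℝ) ^ 2 * hsDiameter σ N ^ 2 +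
              192 * τ * (N + 1 : ℝ) ^ 2 * hsDiameter σ N ^ 2 + 1536 * τ * (N + 1 : ℝ) ^ 3 * hsDiameter σ N ^ 4)) := by
            ring
        _ ≤ 2 * L * M₁ * κ * ((N + 1 : ℝ) * (48 + 1728 * τ)) :=
            mul_le_mul_of_nonneg_left hS (by positivity)
        _ = (A * κ) * (η * (N + 1 : ℝ)) := by rw [hA]; field_simp
        _ ≤ δ * (η * (N + 1 : ℝ)) := mul_le_mul_of_nonneg_right hκA (by positivity)
    rw [mul_div_assoc', le_div_iff₀ (by positivity)]
    exact hgoal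
  have hcast : ((N + 1 : ℕ) : ℝ) = (N + 1 : ℝ) := by push_cast; ring
  calc P {z | η < ((N + 1 : ℝ) * κ)⁻¹ * shortFlightDeficit σ N (Φ N) τ Ψ κ z}
      ≤ P ((Φ N).goodᶜ ∪ B) := measure_mono hsub
    _ ≤ P (Φ N).goodᶜ + P B := measure_union_le _ _
    _ ≤ 0 + ENNReal.ofReal (M₁ * (κ * hsDiameter σ N) * (48 * ((N + 1 : ℕ) : ℝ) ^ 2 * hsDiameter σ N ^ 2 +
          192 * τ * ((N + 1 : ℕ) : ℝ) ^ 2 * hsDiameter σ N ^ 2 +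
          1536 * τ * ((N + 1 : ℕ) : ℝ) ^ 3 * hsDiameter σ N ^ 4) / y) := by
        rw [hgood0]
        exact add_le_add le_rfl hcnt
    _ ≤ ENNReal.ofReal δ := by
        rw [zero_add, hcast]
        exact ENNReal.ofReal_le_ofReal hkey

/-! ## The assembly at `Ξ₁ᴸ`: residual concentrations ⇒ the registered pull-back -/

/-- Elementary: `x · η/(4(x+1)) ≤ η/4` for `x, η ≥ 0`. [folklore] -/
private theorem mul_eta_div_le_u0 {x η : ℝ} (hx : 0 ≤ x) (hη : 0 ≤ η) : x * (η / (4 * (x + 1))) ≤ η / 4 := by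
  rw [show x * (η / (4 * (x + 1))) = η / 4 * (x / (x + 1)) by field_simp]
  exact mul_le_of_le_one_right (by positivity) ((div_le_one (by linarith)).2 (by linarith))

/-- **R2 from its residuals at rung 0, unit mark** (the sibling's `cylinderPullbackStar_rung0_of_residuals` and
`cylinderPullback_rung0_of_star` at `Ψ = Ξ₁ᴸ`, merged): given the mark-generic rung-0 concentrations of the
continuity correction (`h1`) and of the short-flight deficit (`h2`) for marks bounded by `2L`, and the mark-free
three-body collision sum (`h3`), the speed-truncated unit-mark collision statistic `evenStat(Ξ₁ᴸ)` is within `η` of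
the time-integrated tube statistic `evenTubeTimeStat(Ξ₁ᴸ, κ)` outside an event of probability `≤ δ`: on a good
orbit the two differ from `collisionSum − tubeTimeStat … 1 κ` by nothing (exact Enskog slicing,
`evenStat_sub_evenTubeTimeStat_eq`, integrability by `integrableOn_tubeStat_enskogRate_orbit_of_regular` from the
mark-1 S6 `evenTubeStatRegular_one` and 13078's tube statics), the latter is bounded by the
pathwise pull-back `cylinderPullback_pathwise` (`|Ξ₁ᴸ| ≤ 1 ≤ 2L`, continuous, `= 0` for relative speed `≥ 2L`),
the late pairs are `O(ε)` (`residual_latePairs`), and a union bound off the null bad set concludes. [folklore] -/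
theorem cylinderPullbackUnitRung0_of_residuals
    (h1 : ∃ η₀ : ℝ, 0 < η₀ ∧ ∀ (a θ : ℝ) (u : V3), 0 < a → 0 < θ → ∃ σ₀ : ℝ, 0 < σ₀ ∧ ∀ σ : ℝ, 0 < σ → σ < σ₀ → ∀ Φ : (N : ℕ) → HardSphereFlow (Torus.geometry (Fin 3)) (hsDiameter σ N) (N + 1), ∀ τ : ℝ, 0 < τ → ∀ χ : ℝ × UnitAddTorus (Fin 3) → ℝ, Continuous χ → ∀ g : ℝ → ℝ, Continuous g → (∀ a, η₀ ≤ a → g a = 0) → ∀ η δ : ℝ, 0 < η → 0 < δ → ∃ r₀ : ℝ, 0 < r₀ ∧ ∀ r : ℝ, 0 < r → r < r₀ → ∀ L : ℝ, 1 ≤ L → ∃ κ₀ : ℝ, 0 < κ₀ ∧ ∀ κ : ℝ, 0 < κ → κ < κ₀ → ∃ N₀ : ℕ, ∀ N : ℕ, N₀ ≤ N → ∀ Ψ : V3 × V3 × V3 → ℝ, (∀ q, |Ψ q| ≤ 2 * L) → localGibbsLaw σ (fun _ => a) (fun _ => u) (fun _ => θ) N (Φ N) {z | η < ((N + 1 :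 ℝ) * κ)⁻¹ * continuityCorrection σ N (Φ N) τ χ g Ψ r κ z} ≤ ENNReal.ofReal δ)
    (h2 : ∃ η₀ : ℝ, 0 < η₀ ∧ ∀ (a θ : ℝ) (u : V3), 0 < a → 0 < θ → ∃ σ₀ : ℝ, 0 < σ₀ ∧ ∀ σ : ℝ, 0 < σ → σ < σ₀ → ∀ Φ : (N : ℕ) → HardSphereFlow (Torus.geometry (Fin 3)) (hsDiameter σ N) (N + 1), ∀ τ : ℝ, 0 < τ → ∀ χ : ℝ × UnitAddTorus (Fin 3) → ℝ, Continuous χ → ∀ g : ℝ → ℝ, Continuous g → (∀ a, η₀ ≤ a → g a = 0) → ∀ η δ : ℝ, 0 < η → 0 < δ → ∃ r₀ : ℝ, 0 < r₀ ∧ ∀ r : ℝ, 0 < r → r < r₀ → ∀ L : ℝ, 1 ≤ L → ∃ κ₀ : ℝ, 0 < κ₀ ∧ ∀ κ : ℝ, 0 < κ → κ < κ₀ → ∃ N₀ : ℕ, ∀ N : ℕ, N₀ ≤ N → ∀ Ψ : V3 × V3 × V3 → ℝ, (∀ q, |Ψ q| ≤ 2 * L) → localGibbsLaw σ (fun _ =>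 a) (fun _ => u) (fun _ => θ) N (Φ N) {z | η < ((N + 1 : ℝ) * κ)⁻¹ * shortFlightDeficit σ N (Φ N) τ Ψ κ z} ≤ ENNReal.ofReal δ)
    (h3 : ∀ (a θ : ℝ) (u : V3), 0 < a → 0 < θ → ∃ σ₀ : ℝ, 0 < σ₀ ∧ ∀ σ : ℝ, 0 < σ → σ < σ₀ → ∀ Φ : (N : ℕ) → HardSphereFlow (Torus.geometry (Fin 3)) (hsDiameter σ N) (N + 1), ∀ τ : ℝ, 0 < τ → ∀ η δ : ℝ, 0 < η → 0 < δ → ∀ L : ℝ, 1 ≤ L → ∃ κ₀ : ℝ, 0 < κ₀ ∧ ∀ κ : ℝ, 0 < κ → κ < κ₀ → ∃ N₀ : ℕ, ∀ N : ℕ, N₀ ≤ N → localGibbsLaw σ (fun _ => a) (fun _ => u) (fun _ => θ) N (Φ N) {z | η < hsDiameter σ N / (N + 1 : ℝ) * threeBodyCollisionSum σ N (Φ N) τ L κ z} ≤ ENNReal.ofReal δ) :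
    ∃ η₀ : ℝ, 0 < η₀ ∧ ∀ (ab θb : ℝ) (ub : V3), 0 < ab → 0 < θb → ∃ σ₀ : ℝ, 0 < σ₀ ∧ ∀ σ : ℝ, 0 < σ → σ < σ₀ → ∀ Φ : (N : ℕ) → HardSphereFlow (Torus.geometry (Fin 3)) (hsDiameter σ N) (N + 1), ∀ τ : ℝ, 0 < τ → ∀ χ : ℝ × T3 → ℝ, Continuous χ → ∀ g : ℝ → ℝ, Continuous g → (∀ x, η₀ ≤ x → g x = 0) → ∀ η δ : ℝ, 0 < η → 0 < δ → ∃ r₀ : ℝ, 0 < r₀ ∧ ∀ r : ℝ, 0 < r → r < r₀ → ∀ L : ℝ, 1 ≤ L → ∃ κ₀ : ℝ, 0 < κ₀ ∧ ∀ κ : ℝ, 0 < κ → κ < κ₀ → ∃ N₀ : ℕ, ∀ N : ℕ, N₀ ≤ N → localGibbsLaw σ (fun _ => ab) (fun _ => ub) (fun _ => θb) N (Φ N) {z | η < |evenStat σ N (Φ N) τ χ g (fun q : V3 × V3 × V3 => speedCutoff L ‖q.2.2 - q.2.1‖) r z - evenTubeTimeStat σ N (Φ N) τ χ g (fun q : V3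 × V3 × V3 => speedCutoff L ‖q.2.2 - q.2.1‖) r κ z|} ≤ ENNReal.ofReal δ := by
  obtain ⟨η₆, hη₆, H6⟩ := evenTubeStatRegular_one
  obtain ⟨η₁, hη₁, H1⟩ := h1
  obtain ⟨η₂, hη₂, H2⟩ := h2
  refine ⟨min (min η₁ η₂) η₆, lt_min (lt_min hη₁ hη₂) hη₆, ?_⟩
  intro a θ u ha hθ
  obtain ⟨σ₁, hσ₁, H1⟩ := H1 a θ u ha hθ
  obtain ⟨σ₂, hσ₂, H2⟩ := H2 a θ u ha hθ
  obtain ⟨σ₃, hσ₃, H3⟩ := h3 a θ u ha hθ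
  obtain ⟨σ₄, hσ₄, H4⟩ := residual_latePairs (fun _ => a) (fun _ => θ) (fun _ => u)
    continuous_const continuous_const continuous_const (fun _ => ha) (fun _ => hθ)
  refine ⟨min (min (min σ₁ σ₂) (min σ₃ σ₄)) (1 / 4),
    lt_min (lt_min (lt_min hσ₁ hσ₂) (lt_min hσ₃ hσ₄)) (by norm_num), ?_⟩
  intro σ hσ hσlt Φ τ hτ χ hχ g hg hg0 η δ hη hδ
  have hσ4 : σ < 1 / 4 := lt_of_lt_of_le hσlt (min_le_right _ _)
  have hσ' : σ < min (min σ₁ σ₂) (min σ₃ σ₄) := lt_of_lt_of_le hσlt (min_le_left _ _)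
  have hσ₁' : σ < σ₁ := lt_of_lt_of_le hσ' ((min_le_left _ _).trans (min_le_left _ _))
  have hσ₂' : σ < σ₂ := lt_of_lt_of_le hσ' ((min_le_left _ _).trans (min_le_right _ _))
  have hσ₃' : σ < σ₃ := lt_of_lt_of_le hσ' ((min_le_right _ _).trans (min_le_left _ _))
  have hσ₄' : σ < σ₄ := lt_of_lt_of_le hσ' ((min_le_right _ _).trans (min_le_right _ _))
  have hg1 : ∀ a, η₁ ≤ a → g a = 0 := fun a h => hg0 a (((min_le_left _ _).trans (min_le_left _ _)).trans h)
  have hg2 : ∀ a, η₂ ≤ a → g a = 0 := fun a h => hg0 a (((min_le_left _ _).trans (min_le_right _ _)).trans h)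
  have hg6 : ∀ a, η₆ ≤ a → g a = 0 := fun a h => hg0 a ((min_le_right _ _).trans h)
  -- sup constants of `χ` on `[0, τ] × 𝕋³` and of `g` on `[0, ∞)`
  obtain ⟨Cχ, hCχ⟩ := (isCompact_Icc.prod isCompact_univ :
    IsCompact (Icc (0 : ℝ) τ ×ˢ (univ : Set (UnitAddTorus (Fin 3))))).exists_bound_of_continuousOn hχ.continuousOn
  have hχb : ∀ t ∈ Icc (0 : ℝ) τ, ∀ x, |χ (t, x)| ≤ Cχ := fun t ht x => by
    simpa only [Real.norm_eq_abs] using hCχ (t, x) ⟨ht, mem_univ _⟩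
  obtain ⟨Cg, hCg⟩ := (isCompact_Icc (a := (0 : ℝ)) (b := min (min η₁ η₂) η₆)).exists_bound_of_continuousOn
    hg.continuousOn
  have hCg0 : 0 ≤ Cg := (norm_nonneg _).trans (hCg 0 ⟨le_rfl, (lt_min (lt_min hη₁ hη₂) hη₆).le⟩)
  have hgb : ∀ a, 0 ≤ a → |g a| ≤ Cg := by
    intro a ha0'
    rcases le_or_gt a (min (min η₁ η₂) η₆) with hle | hlt
    · simpa only [Real.norm_eq_abs] using hCg a ⟨ha0', hle⟩
    · rw [hg0 a hlt.le, abs_zero]; exact hCg0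
  have hCχ0 : 0 ≤ Cχ := (abs_nonneg _).trans (hχb 0 ⟨le_rfl, hτ.le⟩ 0)
  have hCC : 0 ≤ Cχ * Cg := mul_nonneg hCχ0 hCg0
  -- accuracies (those of `h3`, `h4` are chosen after `L`)
  have hη4 : 0 < η / 4 := by positivity
  have hδ4 : 0 < δ / 4 := by positivity
  have hη2 : 0 < η / (4 * (Cχ * Cg + 1)) := by positivity
  obtain ⟨r₁, hr₁, H1⟩ := H1 σ hσ hσ₁' Φ τ hτ χ hχ g hg hg1 (η / 4) (δ / 4) hη4 hδ4
  obtain ⟨r₂, hr₂, H2⟩ := H2 σ hσ hσ₂' Φ τ hτ χ hχ g hg hg2 (η / (4 * (Cχ * Cg + 1))) (δ / 4) hη2 hδ4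
  refine ⟨min r₁ r₂, lt_min hr₁ hr₂, ?_⟩
  intro r hr hrlt L hL
  have hL0 : 0 < L := one_pos.trans_le hL
  have hr1 : r < r₁ := lt_of_lt_of_le hrlt (min_le_left _ _)
  have hr2 : r < r₂ := lt_of_lt_of_le hrlt (min_le_right _ _)
  have hη3 : 0 < η / (4 * (2 * (Cχ * Cg * (2 * L)) + 1)) := by positivity
  have hη4' : 0 < η / (4 * (Cχ * Cg * (2 * L) + 1)) := by positivity
  obtain ⟨κ₁, hκ₁, H1⟩ := H1 r hr hr1 L hL
  obtain ⟨κ₂, hκ₂, H2⟩ := H2 r hr hr2 L hL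
  obtain ⟨κ₃, hκ₃, H3⟩ := H3 σ hσ hσ₃' Φ τ hτ (η / (4 * (2 * (Cχ * Cg * (2 * L)) + 1))) (δ / 4) hη3 hδ4 L hL
  obtain ⟨κ₄, hκ₄, H4⟩ := H4 σ hσ hσ₄' Φ τ hτ (η / (4 * (Cχ * Cg * (2 * L) + 1))) (δ / 4) hη4' hδ4 L hL
  refine ⟨min (min (min κ₁ κ₂) (min κ₃ κ₄)) (1 / (4 * L)),
    lt_min (lt_min (lt_min hκ₁ hκ₂) (lt_min hκ₃ hκ₄)) (by positivity), ?_⟩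
  intro κ hκ hκlt
  have hκ' : κ < min (min κ₁ κ₂) (min κ₃ κ₄) := lt_of_lt_of_le hκlt (min_le_left _ _)
  have hκL : κ < 1 / (4 * L) := lt_of_lt_of_le hκlt (min_le_right _ _)
  have hκ₁' : κ < κ₁ := lt_of_lt_of_le hκ' ((min_le_left _ _).trans (min_le_left _ _))
  have hκ₂' : κ < κ₂ := lt_of_lt_of_le hκ' ((min_le_left _ _).trans (min_le_right _ _))
  have hκ₃' : κ < κ₃ := lt_of_lt_of_le hκ' ((min_le_right _ _).trans (min_le_left _ _))
  have hκ₄' : κ < κ₄ := lt_of_lt_of_le hκ' ((min_le_right _ _).trans (min_le_right _ _))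
  obtain ⟨N₁, H1⟩ := H1 κ hκ hκ₁'
  obtain ⟨N₂, H2⟩ := H2 κ hκ hκ₂'
  obtain ⟨N₃, H3⟩ := H3 κ hκ hκ₃'
  obtain ⟨N₄, H4⟩ := H4 κ hκ hκ₄'
  refine ⟨max (max N₁ N₂) (max N₃ N₄), fun N hN => ?_⟩
  have hN1 : N₁ ≤ N := ((le_max_left _ _).trans (le_max_left _ _)).trans hN
  have hN2 : N₂ ≤ N := ((le_max_right _ _).trans (le_max_left _ _)).trans hN
  have hN3 : N₃ ≤ N := ((le_max_left _ _).trans (le_max_right _ _)).trans hN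
  have hN4 : N₄ ≤ N := ((le_max_right _ _).trans (le_max_right _ _)).trans hN
  -- the mark `Ξ₁ᴸ`: continuous, `|Ξ₁ᴸ| ≤ 1 ≤ 2L`, `= 0` for relative speed `≥ 2L`
  set Ξ : V3 × V3 × V3 → ℝ := fun q => speedCutoff L ‖q.2.2 - q.2.1‖ with hΞ
  have hΨc : Continuous Ξ := continuous_speedCutoff_mark L
  have hΨb : ∀ p, |Ξ p| ≤ 2 * L := fun p => (abs_speedCutoff_le_one L _).trans (by linarith)
  have hΨ0 : ∀ n v w : V3, 2 * L ≤ ‖w - v‖ → Ξ (n, v, w) = 0 := fun n v w h => speedCutoff_eq_zero hL0 h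
  -- regularity of `A_t` and `W_t` at `Ξ₁ᴸ` (13078's tube statics and the mark-1 S6)
  have hA := Theorems.measurable_tubeStat_uncurry σ N hχ hg hΨc r r 1 κ
  obtain ⟨BA, hBA⟩ := Theorems.exists_bound_tubeStat σ N hχ hg (exists_abs_speedCutoff_mark_le L) hr r
    zero_le_one hκ.le τ
  obtain ⟨hW, BW, hBW⟩ := H6 σ N χ g L r κ τ hσ hχ hg hg6 hL0 hr hκ.le
  have E1 := H1 N hN1 Ξ hΨb
  have E2 := H2 N hN2 Ξ hΨb
  have E3 := H3 N hN3
  have E4 := H4 N hN4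
  -- the minimal-image smallness `ε (1 + 2 L κ) < 1/2`
  have hLκ : 2 * L * κ ≤ 1 / 2 := by
    have : L * κ ≤ L * (1 / (4 * L)) := mul_le_mul_of_nonneg_left hκL.le hL0.le
    rw [show L * (1 / (4 * L)) = 1 / 4 by field_simp] at this
    linarith
  have hsmall : hsDiameter σ N * (1 + 2 * L * κ) < 1 / 2 := by
    have hε := hsDiameter_le hσ.le N
    have hε0 := (hsDiameter_pos hσ N).le
    nlinarith
  -- the union bound on the good set
  set P := localGibbsLaw σ (fun _ => a) (fun _ => u) (fun _ => θ) N (Φ N) with hP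
  set S₁ := {z : Config (N + 1) (Fin 3) T3 | η / 4 <
    ((N + 1 : ℝ) * κ)⁻¹ * continuityCorrection σ N (Φ N) τ χ g Ξ r κ z} with hS₁
  set S₂ := {z : Config (N + 1) (Fin 3) T3 | η / (4 * (Cχ * Cg + 1)) <
    ((N + 1 : ℝ) * κ)⁻¹ * shortFlightDeficit σ N (Φ N) τ Ξ κ z} with hS₂
  set S₃ := {z : Config (N + 1) (Fin 3) T3 | η / (4 * (2 * (Cχ * Cg * (2 * L)) + 1)) <
    hsDiameter σ N / (N + 1 : ℝ) * threeBodyCollisionSum σ N (Φ N) τ L κ z} with hS₃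
  set S₄ := {z : Config (N + 1) (Fin 3) T3 | η / (4 * (Cχ * Cg * (2 * L) + 1)) <
    hsDiameter σ N / (N + 1 : ℝ) * pairShellCount σ N L κ ((Φ N).flow τ z)} with hS₄
  set E := {z : Config (N + 1) (Fin 3) T3 | η <
    |evenStat σ N (Φ N) τ χ g Ξ r z - evenTubeTimeStat σ N (Φ N) τ χ g Ξ r κ z|} with hE
  have hsub : E ∩ (Φ N).good ⊆ ((S₁ ∪ S₂) ∪ S₃) ∪ S₄ := by
    rintro z ⟨hz, hgood⟩
    obtain ⟨hIA, hIe⟩ := integrableOn_tubeStat_enskogRate_orbit_of_regular hgood hσ hA hBA hW hBW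
    rw [hE, Set.mem_setOf_eq, evenStat_sub_evenTubeTimeStat_eq (Φ := Φ N) z hIA hIe] at hz
    by_contra hnot
    simp only [Set.mem_union, not_or, hS₁, hS₂, hS₃, hS₄, Set.mem_setOf_eq, not_lt] at hnot
    obtain ⟨⟨⟨b1, b2⟩, b3⟩, b4⟩ := hnot
    have hpath := cylinderPullback_pathwise σ N (Φ N) τ χ g Ξ r r κ L Cχ Cg (2 * L) z
      hgood hσ hτ hr hκ hL0.le hsmall hχ hg hΨc hχb hgb hΨb hΨ0
    have hc : 0 ≤ ((N + 1 : ℝ) * κ)⁻¹ := by positivity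
    have hεN : 0 ≤ hsDiameter σ N / (N + 1 : ℝ) := by
      have := (hsDiameter_pos hσ N).le; positivity
    have t2 : ((N + 1 : ℝ) * κ)⁻¹ * (Cχ * Cg * shortFlightDeficit σ N (Φ N) τ Ξ κ z) ≤ η / 4 := by
      calc ((N + 1 : ℝ) * κ)⁻¹ * (Cχ * Cg * shortFlightDeficit σ N (Φ N) τ Ξ κ z)
          = Cχ * Cg * (((N + 1 : ℝ) * κ)⁻¹ * shortFlightDeficit σ N (Φ N) τ Ξ κ z) := by ring
        _ ≤ Cχ * Cg * (η / (4 * (Cχ * Cg + 1))) := mul_le_mul_of_nonneg_left b2 hCC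
        _ ≤ η / 4 := mul_eta_div_le_u0 hCC hη.le
    have t3 : Cχ * Cg * (2 * L) * (hsDiameter σ N / (N + 1 : ℝ)) *
        (2 * threeBodyCollisionSum σ N (Φ N) τ L κ z) ≤ η / 4 := by
      calc Cχ * Cg * (2 * L) * (hsDiameter σ N / (N + 1 : ℝ)) * (2 * threeBodyCollisionSum σ N (Φ N) τ L κ z)
          = 2 * (Cχ * Cg * (2 * L)) * (hsDiameter σ N / (N + 1 : ℝ) * threeBodyCollisionSum σ N (Φ N) τ L κ z) := by
            ring
        _ ≤ 2 * (Cχ * Cg * (2 * L)) * (η / (4 * (2 * (Cχ * Cg * (2 * L)) + 1))) :=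
            mul_le_mul_of_nonneg_left b3 (by positivity)
        _ ≤ η / 4 := mul_eta_div_le_u0 (by positivity) hη.le
    have t4 : Cχ * Cg * (2 * L) * (hsDiameter σ N / (N + 1 : ℝ)) * pairShellCount σ N L κ ((Φ N).flow τ z) ≤ η / 4 := by
      calc Cχ * Cg * (2 * L) * (hsDiameter σ N / (N + 1 : ℝ)) * pairShellCount σ N L κ ((Φ N).flow τ z)
          = Cχ * Cg * (2 * L) * (hsDiameter σ N / (N + 1 : ℝ) * pairShellCount σ N L κ ((Φ N).flow τ z)) := by ring
        _ ≤ Cχ * Cg * (2 * L) * (η / (4 * (Cχ * Cg * (2 * L) + 1))) := mul_le_mul_of_nonneg_left b4 (by positivity)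
        _ ≤ η / 4 := mul_eta_div_le_u0 (by positivity) hη.le
    have hle : |collisionSum σ N (Φ N) τ χ g Ξ r z - tubeTimeStat σ N (Φ N) τ χ g Ξ r r 1 κ z| ≤ η := by
      refine hpath.trans ?_
      rw [mul_add, mul_add]
      linarith
    exact (not_lt.2 hle) hz
  have hgoodc : P (Φ N).goodᶜ = 0 := localGibbsLaw_goodCompl (Φ N)
  calc P E = P (E ∩ (Φ N).good ∪ E \ (Φ N).good) := by rw [Set.inter_union_sdiff]
    _ ≤ P (E ∩ (Φ N).good) + P (E \ (Φ N).good) := measure_union_le _ _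
    _ ≤ P (((S₁ ∪ S₂) ∪ S₃) ∪ S₄) + 0 := by
        refine add_le_add (measure_mono hsub) ?_
        exact (measure_mono fun z hz => hz.2).trans hgoodc.le
    _ ≤ P S₁ + P S₂ + P S₃ + P S₄ := by
        rw [add_zero]
        exact (measure_union_le _ _).trans (add_le_add ((measure_union_le _ _).trans
          (add_le_add (measure_union_le _ _) le_rfl)) le_rfl)
    _ ≤ ENNReal.ofReal (δ / 4) + ENNReal.ofReal (δ / 4) + ENNReal.ofReal (δ / 4) + ENNReal.ofReal (δ / 4) :=
        add_le_add (add_le_add (add_le_add E1 E2) E3) E4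
    _ = ENNReal.ofReal δ := by
        rw [← ENNReal.ofReal_add hδ4.le hδ4.le, ← ENNReal.ofReal_add (by positivity) hδ4.le,
          ← ENNReal.ofReal_add (by positivity) hδ4.le]
        congr 1
        ring

/-! ## The registered stub -/

/-- **R2 · CYLINDER PULL-BACK AT RUNG 0, UNIT MARK** (registered stub `stub_cylinderPullbackUnitRung0` of the line
`Sketch`, crux `InformationPercolationEngine.CollisionRate`, stmt-AtomisticToContinuum-13481; mark-1 twin of the
sibling's `EvenStressEnskog.cylinderPullback_rung0_of_residuals`).  Under the homogeneous canonical law the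
speed-truncated unit-mark collision statistic `evenStat(Ξ₁ᴸ)` equals the time-integrated tube statistic
`evenTubeTimeStat(Ξ₁ᴸ, κ)` up to `η` outside an event of probability `≤ δ`, for `κ < κ₀` and `N ≥ N₀`:
`cylinderPullbackUnitRung0_of_residuals` fed with the three rung-0 residual concentrations — the continuity
correction (`Literature.….localGibbsLaw_continuityCorrection_rung0_of_shortFlightDeficit`, its statics discharged by
`measurePreserving_flow_localGibbsLaw_const`, `exists_sweptTube`, `volume_setOf_exists_reprSym_add_latticeVec_mem_le`,
`EvenStressEnskog.stub_kineticEnergyTight`, `Theorems.stub_meanDisplacement`), the short-flight deficit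
(`shortFlightDeficitRung0_mark`) and the three-body collision sum (`EvenStressEnskog.stub_threeBodyCollisionSumRung0`).
[folklore] -/
theorem stub_cylinderPullbackUnitRung0 :
    ∃ η₀ : ℝ, 0 < η₀ ∧ ∀ (ab θb : ℝ) (ub : V3), 0 < ab → 0 < θb → ∃ σ₀ : ℝ, 0 < σ₀ ∧ ∀ σ : ℝ, 0 < σ → σ < σ₀ →
      ∀ Φ : (N : ℕ) → HardSphereFlow (Torus.geometry (Fin 3)) (hsDiameter σ N) (N + 1),
      ∀ τ : ℝ, 0 < τ → ∀ χ : ℝ × T3 → ℝ, Continuous χ → ∀ g : ℝ → ℝ, Continuous g →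
      (∀ x, η₀ ≤ x → g x = 0) →
      ∀ η δ : ℝ, 0 < η → 0 < δ → ∃ r₀ : ℝ, 0 < r₀ ∧ ∀ r : ℝ, 0 < r → r < r₀ →
      ∀ L : ℝ, 1 ≤ L → ∃ κ₀ : ℝ, 0 < κ₀ ∧ ∀ κ : ℝ, 0 < κ → κ < κ₀ → ∃ N₀ : ℕ, ∀ N : ℕ, N₀ ≤ N →
        localGibbsLaw σ (fun _ => ab) (fun _ => ub) (fun _ => θb) N (Φ N)
          {z | η < |evenStat σ N (Φ N) τ χ g (fun q : V3 × V3 × V3 => speedCutoff L ‖q.2.2 - q.2.1‖) r z -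
              evenTubeTimeStat σ N (Φ N) τ χ g (fun q : V3 × V3 × V3 => speedCutoff L ‖q.2.2 - q.2.1‖) r κ z|}
          ≤ ENNReal.ofReal δ :=
  cylinderPullbackUnitRung0_of_residuals
    (localGibbsLaw_continuityCorrection_rung0_of_shortFlightDeficit measurePreserving_flow_localGibbsLaw_const
      (fun _ _ hε hh => exists_sweptTube hε hh)
      (fun B hB => by simpa only [sub_zero] using volume_setOf_exists_reprSym_add_latticeVec_mem_le 0 hB)
      (fun a θ u ha hθ => stub_kineticEnergyTight (fun _ => a) (fun _ => θ) (fun _ => u) continuous_const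
        continuous_const continuous_const (fun _ => ha) (fun _ => hθ))
      (fun _ _ Φ _ hz s s' => Theorems.stub_meanDisplacement Φ hz s s') shortFlightDeficitRung0_mark)
    shortFlightDeficitRung0_mark stub_threeBodyCollisionSumRung0

end Summit.AtomisticToContinuum.HydrodynamicLimit.Theorems.CollisionRate

end
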